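import Literature.AnabelianGeometry.SemiGraphs.UniversalCoveringCor39
import Literature.AnabelianGeometry.SemiGraphs.TemperedReconstructionCor39LocallyFinite
import Literature.AnabelianGeometry.SemiGraphs.TemperedHbddOfLocallyFinite
import Literature.AnabelianGeometry.SemiGraphs.TemperedCoveringsComponentsProofs
import HarnessLib

/-!
# The covering semi-graph `𝔾_S` of EVERY object `S ∈ B^cov(G)` over a locally finite `𝔾` is locally finite;
# (CE) «every compact element is verticial» HOLDS at the universal graph-coverings `𝒢_{∞,F}`

Mochizuki, *Semi-graphs of anabelioids*, Publ. RIMS **42** (2006), §1 p. 13 ("locally finite"), §2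
p. 23 and §3 Def. 3.5 (i) p. 37 (the covering semi-graph of anabelioids `G_S → G`: "the vertices `v'`
(respectively, edges `e'`) of `G'` [over `v`, `e`] are the elements of the set of connected components",
i.e. the `Π_v`-orbits of `S_v`, the `Π_e`-orbits of `S_e`), Thm. 3.7 (iii) pp. 40–41, Cor. 3.9 pp. 42–43
[cite: MochizukiSemiAnbd2006, Def 3.5(i) p.37].

PROOF-ONLY file (cell abc-iut, layer L3, L-F pack A row «COR39@UNIV-COVERINGS», L3-lead gen 6 rulings
β13 (1) / β24; seat abc-iut-L3-d1 gen 7; no definition, no new named fact).  Ruling β24 asked for the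
"local finiteness of `𝒢_{∞,F}`" as an input BY NAME; the tree had it only for the orbit graph of a FINITE
covering object (`CovObj.orbitGraph_isLocallyFinite`, abc-iut-w6-d062).  The one genuine observation
of this file: a `Π_v`-ORBIT of a point of an object of `B^temp(Π_v)`, `Π_v` COMPACT, is FINITE (its
stabiliser is open, hence of finite index), so the covering semi-graph `𝔾_S` (`CovObj.coveringSemiGraph`,
vertices/edges = orbits) of ANY object `S` of `B^cov(G)` — finite or not, tempered or not — has at each
vertex-orbit `(v, ω_v)` at most `(#branches at v) · #ω_v` branches: `𝔾_S` is locally finite as soon as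
`𝔾` is.  In particular every universal graph-covering `𝒢_{∞,F}` over a finite (or locally finite) base is
locally finite, abc-iut-L3-t10's locally-finite closers apply there verbatim, and (CE) holds at
`𝒢_{∞,F}` over a finite coherent Thm-3.7 base (from abc-iut-w6-d120's `CompactInVerticialAt` there).

* `BTemp.finite_orbit`, `BTemp.finite_orbitPts` — orbits in objects of `B^temp(Π)`, `Π` compact, are
  finite;
* `CovObj.finite_branches_coveringSemiGraph`, `CovObj.isLocallyFinite_coveringGraph` — `𝔾_S` is locally
  finite for EVERY `S ∈ B^cov(G)` over a locally finite `𝔾`; `CovObj.isLocallyFinite_univCoverOver`;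
* `CovObj.forall_mem_exists_verticial_univCoverOver` — (CE) at `𝒢_{∞,F}` (finite `F`, finite coherent
  Thm-3.7 base), and an `example` re-deriving `CovObj.cor39UpToTwistAt_univCoverOver` (p458056) by ONE
  application of abc-iut-L3-t10's `cor39UpToTwistAt_of_isLocallyFinite` (β24's ratified shape) — the two
  routes agree.

HONEST FRAMING.  A chain-pair instance is evidence for the locally-finite regime, not a closer of the
kernel-refuted ∀-countable `Cor39Compat`/`Cor39CompatUpToTwist` (C-R33); nothing here bears on
[IUTchIII] Cor. 3.12 and nothing asserts abc proved or refuted.  typed ≠ proved.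
-/

open CategoryTheory Topology

namespace Literature.AnabelianGeometry.SemiGraphs

open Literature.AlgebraicGeometry.Frobenioids.QuasiTemperoid.BTempConnected (ρ_mul_apply ρ_inv_apply)

universe u

/-! ### Orbits in objects of `B^temp(Π)`, `Π` compact, are finite -/

namespace BTemp

variable {G : Type u} [Group G] [TopologicalSpace G] [IsTopologicalGroup G] [CompactSpace G]

/-- **In an object `X` of `B^temp(Π)` with `Π` compact, the `Π`-orbit of every point is finite**: the
stabiliser is open (continuity of the action on the discrete set `X`), hence of finite index in the
compact group `Π`, and the orbit is the image of `Π/Stab`. [cite: MochizukiSemiAnbd2006, §3 p.33] -/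
theorem finite_orbit (X : BTemp G) (x : X.obj.V) : Set.Finite {y : X.obj.V | ∃ g : G, X.obj.ρ g x = y} := by
  haveI : Finite (G ⧸ stab X x) := Subgroup.quotient_finite_of_isOpen _ (X.property.2 x)
  let f : G ⧸ stab X x → X.obj.V := fun q => Quotient.liftOn' q (fun g => X.obj.ρ g x) (by
    intro a b hab
    rw [QuotientGroup.leftRel_apply] at hab
    have hfix : X.obj.ρ (a⁻¹ * b) x = x := hab
    change X.obj.ρ a x = X.obj.ρ b x
    conv_lhs => rw [← hfix]
    rw [← ρ_mul_apply, mul_inv_cancel_left])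
  refine (Set.finite_range f).subset ?_
  rintro y ⟨g, rfl⟩
  exact ⟨(g : G ⧸ stab X x), rfl⟩

/-- The set of points of a given orbit `ω` of an object of `B^temp(Π)`, `Π` compact, is finite.
[cite: MochizukiSemiAnbd2006, §3 p.33] -/
theorem finite_orbitPts (X : BTemp G) (ω : Orbits X) : Set.Finite {s : X.obj.V | cl X s = ω} := by
  refine (finite_orbit X (Quot.out ω)).subset fun s hs => ?_
  have h : cl X s = cl X (Quot.out ω) := (hs : cl X s = ω).trans (Quot.out_eq ω).symm
  obtain ⟨g, hg⟩ := (cl_eq_cl_iff X s _).mp h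
  exact ⟨g⁻¹, by rw [← hg, ρ_inv_apply]⟩

end BTemp

namespace ProfiniteSemiGraph

variable {𝒢 : ProfiniteSemiGraph.{u}}

namespace CovObj

variable (S : CovObj 𝒢)

/-! ### The covering semi-graph of ANY object of `B^cov(G)` over a locally finite `𝔾` is locally finite -/

/-- **The branches of `𝔾_S` at a vertex-orbit `(v, ω_v)` are finite in number** as soon as `v` carries
finitely many branches: such a branch is a pair `(b, ω)` with `b` a branch of `𝔾` at `v` and `ω` a
`Π_e`-orbit of `S_e` glued INTO the finite `Π_v`-orbit `ω_v` (the gluing is injective on points), for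
EVERY object `S` (no finiteness of the fibres). [cite: MochizukiSemiAnbd2006, Def 3.5(i) p.37] -/
theorem finite_branches_coveringSemiGraph (V : S.coveringSemiGraph.Vertex)
    (hv : Set.Finite {b : 𝒢.graph.Branch | 𝒢.graph.abuts b = some V.1}) :
    Set.Finite {B : S.coveringSemiGraph.Branch | S.coveringSemiGraph.abuts B = some V} := by
  obtain ⟨v, ωv⟩ := V
  -- over one branch `b` at `v`: the orbits glued into `ω_v` inject into the (finite) points of `ω_v`
  have hfin : ∀ (b : 𝒢.graph.Branch) (hb : 𝒢.graph.abuts b = some v),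
      Set.Finite {ω : BTemp.Orbits (S.SE (𝒢.graph.edgeOf b)) | S.glueOrbit b v hb ω = ωv} := by
    intro b hb
    refine Set.Finite.of_finite_image ((BTemp.finite_orbitPts (S.SV v) ωv).subset ?_)
      (f := fun ω => (S.glue b v hb).hom.hom.hom (Quot.out ω)) (fun ω₁ _ ω₂ _ h => ?_)
    · rintro _ ⟨ω, hω, rfl⟩
      change BTemp.cl (S.SV v) ((S.glue b v hb).hom.hom.hom (Quot.out ω)) = ωv
      calc BTemp.cl (S.SV v) ((S.glue b v hb).hom.hom.hom (Quot.out ω))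
          = S.glueOrbit b v hb (BTemp.cl _ (Quot.out ω)) := rfl
        _ = S.glueOrbit b v hb ω := congrArg _ (Quot.out_eq ω)
        _ = ωv := hω
    · have hout : Quot.out ω₁ = Quot.out ω₂ := S.glue_hom_injective b v hb h
      calc ω₁ = BTemp.cl _ (Quot.out ω₁) := (Quot.out_eq ω₁).symm
        _ = BTemp.cl _ (Quot.out ω₂) := congrArg _ hout
        _ = ω₂ := Quot.out_eq ω₂
  -- the abutting branches lie in the finite union over the branches `b` at `v`
  refine (hv.biUnion (t := fun b => {B : S.coveringSemiGraph.Branch |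
      B.1 = b ∧ S.coveringSemiGraph.abuts B = some ⟨v, ωv⟩}) fun b hb => ?_).subset ?_
  · refine ((hfin b hb).image fun ω => (⟨b, ω⟩ : S.coveringSemiGraph.Branch)).subset ?_
    rintro ⟨b', ω⟩ ⟨hb', hB⟩
    change b' = b at hb'
    subst hb'
    exact ⟨ω, S.glueOrbit_eq_of_coveringAbuts hB, rfl⟩
  · rintro ⟨b, ω⟩ hB
    have hb : 𝒢.graph.abuts b = some v := S.abuts_of_coveringAbuts hB
    simp only [Set.mem_iUnion, Set.mem_setOf_eq, exists_prop]
    exact ⟨b, hb, rfl, hB⟩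

/-- **The covering semi-graph `𝔾_S` of EVERY object `S ∈ B^cov(G)` over a LOCALLY FINITE `𝔾` is
locally finite** (the vertex-orbits are finite `Π_v`-orbits; no finiteness or temperedness of `S`).
[cite: MochizukiSemiAnbd2006, Def 3.5(i) p.37] -/
theorem isLocallyFinite_coveringGraph (hlf : 𝒢.graph.IsLocallyFinite) :
    S.coveringGraph.graph.IsLocallyFinite := by
  refine ⟨fun V => ?_⟩
  refine ((S.finite_branches_coveringSemiGraph V (𝒢.finite_branches_of_isLocallyFinite hlf V.1)).image
    S.coveringSemiGraph.edgeOf).subset ?_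
  rintro E ⟨B, hBE, hBV⟩
  exact ⟨B, hBV, hBE⟩

/-- In particular over a FINITE `𝔾`. [cite: MochizukiSemiAnbd2006, Def 3.5(i) p.37] -/
theorem isLocallyFinite_coveringGraph_of_finite [Finite 𝒢.graph.Edge] :
    S.coveringGraph.graph.IsLocallyFinite :=
  S.isLocallyFinite_coveringGraph isLocallyFinite_of_finite_edge

/-- **The universal graph-covering `𝒢_{∞,S}` over a locally finite `𝔾` is locally finite**, for every
object `S`, base component `c` and countability witness. [cite: MochizukiSemiAnbd2006, Prop 3.6 p.38] -/
theorem isLocallyFinite_univCoverOver (hlf : 𝒢.graph.IsLocallyFinite) (c : S.orbitGraph.CatCarrier)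
    (h𝒢 : 𝒢.IsCountable) : (S.univCoverOver c h𝒢).coveringGraph.graph.IsLocallyFinite :=
  (S.univCoverOver c h𝒢).isLocallyFinite_coveringGraph hlf

/-! ### (CE) at `𝒢_{∞,F}`, and Cor. 3.9 at chain pairs through the locally finite closers -/

variable {ℋ : ProfiniteSemiGraph.{u}} (F : CovObj 𝒢) (F' : CovObj ℋ)

/-- **(CE) «every compact element is verticial» HOLDS at `𝒢_{∞,F}`** — the universal graph-covering over
a FINITE covering object `F` of a FINITE coherent Thm-3.7 graph, every chart: every element of every
compact subgroup of `π₁^temp(𝒢_{∞,F})` lies in a verticial subgroup (Thm. 3.7 (iii) AT `𝒢_{∞,F}`,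
abc-iut-w6-d120, read elementwise through abc-iut-w6-d062's locally finite equivalence — `𝒢_{∞,F}` being
locally finite by the above). [cite: MochizukiSemiAnbd2006, Thm 3.7(iii) pp.40-41] -/
theorem forall_mem_exists_verticial_univCoverOver [Finite 𝒢.graph.Vertex] [Finite 𝒢.graph.Edge]
    (h37 : 𝒢.Thm37Hypotheses) (hcoh : 𝒢.IsCoherent) (hF : F.IsFinite) (V₀ : F.OVertex)
    (h𝒢 : 𝒢.IsCountable) (c : TemperedPiChart (F.univCoverOver (Sum.inl V₀) h𝒢).coveringGraph)
    (K : Subgroup c.G) (hK : IsCompact (K : Set c.G)) :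
    ∀ g ∈ K, ∃ (w : (F.univCoverOver (Sum.inl V₀) h𝒢).coveringGraph.graph.Vertex)
      (H : Subgroup c.G), H ∈ verticialSubgroups c w ∧ g ∈ H :=
  forall_mem_exists_verticial_of_compactInVerticialAt_of_isLocallyFinite
    (F.routeTInvariant_univCoverOver h37 hcoh hF V₀).1
    (F.isLocallyFinite_univCoverOver isLocallyFinite_of_finite_edge _ h𝒢)
    (F.compactInVerticialAt_univCoverOver h37 hcoh hF V₀) c K hK

/-- β24's ratified shape, as a sanity link: `CovObj.cor39UpToTwistAt_univCoverOver` (p458056), statement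
verbatim, RE-DERIVED by ONE application of abc-iut-L3-t10's `cor39UpToTwistAt_of_isLocallyFinite` with
(CE) on both sides from `forall_mem_exists_verticial_univCoverOver` and local finiteness of
`𝒢_{∞,F}`, `ℋ_{∞,F′}` from `isLocallyFinite_univCoverOver` — the two routes to Cor. 3.9 at a chain pair
agree. [cite: MochizukiSemiAnbd2006, Cor 3.9 pp.42-43] -/
example [Finite 𝒢.graph.Vertex] [Finite 𝒢.graph.Edge] [Finite ℋ.graph.Vertex] [Finite ℋ.graph.Edge]
    (h𝒢 : Cor39Hypotheses 𝒢) (hcoh : 𝒢.IsCoherent) (hℋ : Cor39Hypotheses ℋ) (hcohℋ : ℋ.IsCoherent)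
    (hF : F.IsFinite) (V₀ : F.OVertex) (hF' : F'.IsFinite) (W₀ : F'.OVertex) (hc𝒢 : 𝒢.IsCountable)
    (hcℋ : ℋ.IsCountable) (c : TemperedPiChart (F.univCoverOver (Sum.inl V₀) hc𝒢).coveringGraph)
    (c' : TemperedPiChart (F'.univCoverOver (Sum.inl W₀) hcℋ).coveringGraph) :
    (∀ (Φ : Hom (F.univCoverOver (Sum.inl V₀) hc𝒢).coveringGraph
        (F'.univCoverOver (Sum.inl W₀) hcℋ).coveringGraph), Φ.IsLocallyOpen → ∀ φ : c.G →ₜ* c'.G,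
        (∃ θ : Φ.ConjugatorFamily, Nonempty (Φ.chartPullbackWith θ c c' ≅ BTemp.res φ)) →
          IsCompatiblyQuasiGeometric φ) ∧
      ∀ φ : c.G →ₜ* c'.G, IsCompatiblyQuasiGeometric φ →
        ∃ Φ : Hom (F.univCoverOver (Sum.inl V₀) hc𝒢).coveringGraph
            (F'.univCoverOver (Sum.inl W₀) hcℋ).coveringGraph, Φ.IsLocallyOpen ∧
          (∃ θ : Φ.ConjugatorFamily, Nonempty (Φ.chartPullbackWith θ c c' ≅ BTemp.res φ)) ∧
          ∀ Φ' : Hom (F.univCoverOver (Sum.inl V₀) hc𝒢).coveringGraph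
              (F'.univCoverOver (Sum.inl W₀) hcℋ).coveringGraph, Φ'.IsLocallyOpen →
            (∃ θ' : Φ'.ConjugatorFamily, Nonempty (Φ'.chartPullbackWith θ' c c' ≅ BTemp.res φ)) →
              Φ'.base.vertexMap = Φ.base.vertexMap ∧ Φ'.base.edgeMap = Φ.base.edgeMap :=
  cor39UpToTwistAt_of_isLocallyFinite (F.isLocallyFinite_univCoverOver isLocallyFinite_of_finite_edge _ hc𝒢)
    (F'.isLocallyFinite_univCoverOver isLocallyFinite_of_finite_edge _ hcℋ)
    (F.forall_mem_exists_verticial_univCoverOver h𝒢.thm37Hypotheses hcoh hF V₀ hc𝒢)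
    (F'.forall_mem_exists_verticial_univCoverOver hℋ.thm37Hypotheses hcohℋ hF' W₀ hcℋ)
    (F.cor39Hypotheses_univCoverOver h𝒢 hcoh hF V₀ hc𝒢)
    (F'.cor39Hypotheses_univCoverOver hℋ hcohℋ hF' W₀ hcℋ) c c'

end CovObj

end ProfiniteSemiGraph

end Literature.AnabelianGeometry.SemiGraphs
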